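import Mathlib
import HarnessLib
import Literature.Computability.AlgebraicComplexity.BKRRSS25ConstantDepthFactorClosure
import Summits.ValiantsHypothesis.ValiantsHypothesis.Theorems.DefinabilityGapK1DepthLadder
import Summits.ValiantsHypothesis.ValiantsHypothesis.Theorems.DefinabilityGapK1cdOfBKRRSS25

/-!
# DefinabilityGap — the GROWING depth rung of `K1 = KIPlantedHitting`, modulo the NAMED uniform fact
# `Literature.Computability.AlgebraicComplexity.BhattacharjeeEtAl2025_thm1_uniform`
# (support for item `stmt-ValiantsHypothesis-23547`; decomp-valiant lens 5, generation 14)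

Bookkeeping bridge (no new mathematics): lens 5's kernel
`DefinabilityGapK1DepthLadder.k1AtDepth_log3_of_uniformFactorClosure` (p773541, generation 13) proves the first
`K1` rung at UNBOUNDED annihilator depth — for every slope `p/q ≤ 18/25`, every size exponent `b` and
infinitely often in `m`, the Kabanets–Impagliazzo planted permanent map `G_m = kiPer m` hits every nonzero
`D` of degree `≤ q(m)^b` computed with `≤ q(m)^b` wires in product-depth `≤ ⌊(p/q) · log₂log₂log₂ m⌋` — from
the 2025 closure theorem of Bhattacharjee–Kumar–Rai–Ramanathan–Saptharishi–Saraf SPELLED OUT, in its UNIFORM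
reading (absolute additive depth constant `c₀`, absolute wire exponent `a`), as the hypothesis `hfac`. The
decomp-valiant critic print-checked that reading (Thm. 29 is stated for arbitrary depth with `poly(s,d,n)` and
`O(1)` independent of the depth; bus line 705) and endorsed typing it; generation 14 typed it as the Literature
named fact `BhattacharjeeEtAl2025_thm1_uniform` (same binders, `∃ c₀ a` outside `∀ Δ`). This file records the
rung in the form "named uniform fact → growing rung", so that the ledger sees a CONDITIONAL result on ONE
citable print theorem [BhattacharjeeEtAl2025, Thm. 1 / Thm. 29] rather than an anonymous hypothesis, and
notes that the same registered fact also carries the constant-depth rung `K1cd` (census bridge p773567) via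
`bkrrss25_thm1_of_uniform` (uniform ⟹ non-uniform, proved here).

Net ladder picture for the record (all kernel): bottom `K1pd(⌊σ L₃ m⌋)`, every `σ ≤ 0.72`, THEOREM modulo
the registered uniform fact (this file); constant rungs `K1cd` THEOREM modulo the registered (non-uniform or
uniform) fact; top `K1pd(O(b log m)) ⟺ K1 ⟸ S` unconditional (`DefinabilityGapK1DepthLadderTop`). Between
`0.72 L₃` and `O(log)` lies lens 4's depth window: one shared wall. Honest framing: every rung is an
S-implied SLICE of the declared residual-side conjunct `K1` of route `DefinabilityGap` (rung currency,
LADDER-Valiant rung 0); nothing here bears on `VP ≠ VNP`, which is NOT proved.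
-/

set_option linter.dupNamespace false

noncomputable section

open MvPolynomial
open Literature.Computability.AlgebraicComplexity Literature.Computability.MetaComplexity
open Summit.ValiantsHypothesis.ValiantsHypothesis.Theorems.DefinabilityGapAffineRung (qOf kiPer)
open Summit.ValiantsHypothesis.ValiantsHypothesis.Theorems.DefinabilityGapK1DepthLadder
  (k1AtDepth_log3_of_uniformFactorClosure)
open Summit.ValiantsHypothesis.ValiantsHypothesis.Theorems.DefinabilityGapK1cdOfBKRRSS25
  (kiPlantedHittingCD_of_bkrrss25)

namespace Summit.ValiantsHypothesis.ValiantsHypothesis.Theorems.DefinabilityGapK1Log3OfBKRRSS25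

/-- The uniform named fact implies the non-uniform one typed by the census (take `Δ' := Δ + c₀` and the same
exponent `a` for every `Δ`): the generation-14 typing is a strengthening of, and consistent with, the
generation-19-census typing `BhattacharjeeEtAl2025_thm1`. [cite: BhattacharjeeEtAl2025, Thm. 1] -/
theorem bkrrss25_thm1_of_uniform (h : BhattacharjeeEtAl2025_thm1_uniform) : BhattacharjeeEtAl2025_thm1 := by
  obtain ⟨c₀, a, hfac⟩ := h
  intro Δ
  exact ⟨Δ + c₀, a, fun σ _ _ P Q Γ hΓ hΔ hP hQ => hfac Δ σ P Q Γ hΓ hΔ hP hQ⟩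

/-- **The growing rung of `K1` at every slope `p/q ≤ 18/25`, modulo the named uniform fact
[BhattacharjeeEtAl2025, Thm. 1 / Thm. 29].** For every size exponent `b` and every `m₀` there is `m ≥ m₀`
such that `G_m = kiPer m` hits every nonzero `D` of degree `≤ q^b` computed by an unbounded-fan-in circuit of
product-depth `≤ ⌊(p/q) · log₂log₂log₂ m⌋` with `≤ q^b` wires (`q = qOf m`) — from
`BhattacharjeeEtAl2025_thm1_uniform` by lens 5's `k1AtDepth_log3_of_uniformFactorClosure` (whose hardness
input is the robust permanent rung `perHard_io_log3`, i.e. lens 4's `immHardAt_of_le_18_25` transported to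
the permanent). CONDITIONAL on the named fact. [cite: BhattacharjeeEtAl2025, Thm. 1, Thm. 29, Thm. 37]
[cite: KabanetsImpagliazzo2003, Thm. 7.7] [cite: BhargavDuttaSaxena2024, Thm. 1.4] -/
theorem k1AtDepth_log3_of_bkrrss25_uniform {p q : ℕ} (hpq : 25 * p ≤ 18 * q)
    (h : BhattacharjeeEtAl2025_thm1_uniform) :
    ∀ b m₀ : ℕ, ∃ m, m₀ ≤ m ∧
      ∀ (Γ : ArithCircuit ℂ (Fin 3 → Fin (qOf m))) (D : MvPolynomial (Fin 3 → Fin (qOf m)) ℂ),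
        Γ.Computes D → Γ.productDepth ≤ p * Nat.log 2 (Nat.log 2 (Nat.log 2 m)) / q →
        Γ.edgeSize ≤ qOf m ^ b → D ≠ 0 → D.totalDegree ≤ qOf m ^ b → bind₁ (kiPer m) D ≠ 0 := by
  obtain ⟨c₀, a, hfac⟩ := h
  exact k1AtDepth_log3_of_uniformFactorClosure (c₀ := c₀) (a := a) hpq hfac

/-- **The growing rung at the endpoint slope `18/25 = 0.72`, modulo the named uniform fact**: `K1` for
annihilators of product-depth `≤ ⌊0.72 · log₂log₂log₂ m⌋` and `≤ q^b` wires.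
[cite: BhattacharjeeEtAl2025, Thm. 1, Thm. 29] [cite: BhargavDuttaSaxena2024, Thm. 1.4] -/
theorem k1AtDepth_log3_18_25_of_bkrrss25_uniform (h : BhattacharjeeEtAl2025_thm1_uniform) :
    ∀ b m₀ : ℕ, ∃ m, m₀ ≤ m ∧
      ∀ (Γ : ArithCircuit ℂ (Fin 3 → Fin (qOf m))) (D : MvPolynomial (Fin 3 → Fin (qOf m)) ℂ),
        Γ.Computes D → Γ.productDepth ≤ 18 * Nat.log 2 (Nat.log 2 (Nat.log 2 m)) / 25 →
        Γ.edgeSize ≤ qOf m ^ b → D ≠ 0 → D.totalDegree ≤ qOf m ^ b → bind₁ (kiPer m) D ≠ 0 :=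
  k1AtDepth_log3_of_bkrrss25_uniform (p := 18) (q := 25) le_rfl h

/-- One registered fact carries both typed rungs: the uniform fact also yields the constant-depth rung
`K1cd` (census bridge `kiPlantedHittingCD_of_bkrrss25`, p773567) through
`bkrrss25_thm1_of_uniform`. [cite: BhattacharjeeEtAl2025, Thm. 1] -/
theorem kiPlantedHittingCD_of_bkrrss25_uniform (h : BhattacharjeeEtAl2025_thm1_uniform) :
    ∀ Δ b m₀ : ℕ, ∃ m, m₀ ≤ m ∧
      ∀ (Γ : ArithCircuit ℂ (Fin 3 → Fin (qOf m))) (D : MvPolynomial (Fin 3 → Fin (qOf m)) ℂ),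
        Γ.Computes D → Γ.productDepth ≤ Δ → Γ.edgeSize ≤ qOf m ^ b → D ≠ 0 → D.totalDegree ≤ qOf m ^ b →
        bind₁ (kiPer m) D ≠ 0 :=
  kiPlantedHittingCD_of_bkrrss25 (bkrrss25_thm1_of_uniform h)

end Summit.ValiantsHypothesis.ValiantsHypothesis.Theorems.DefinabilityGapK1Log3OfBKRRSS25

end
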